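import Mathlib
import Literature.NumberTheory.LFunctions.Zhang2022.TypedSection18
import Literature.NumberTheory.LFunctions.Zhang2022.Section18SjNormSizes
import Literature.NumberTheory.LFunctions.Zhang2022.Section18Ded183
import HarnessLib

/-!
# Zhang (2022) §18, proof of (2.33): the proof node `Z22:(2.33).pf` and the leaf `Ded183` from the
# typed displays, with Proposition 7.1's error term discharged

Topic `Literature/NumberTheory/LFunctions/Zhang2022` (Landau–Siegel audit tree; verdict-neutral).
Y. Zhang, *Discrete mean estimates and the Landau–Siegel zero*, arXiv:2211.02515v1 (2022)
[Zhang2022LandauSiegel], §18 pp. 99–100 (tex L4914–L4955), "Proof of (2.33)" — an unrefereed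
manuscript under adjudication (campaign D-0069, discharge layer L4; cone leaf C27
`Skeleton.Ded183 c′`; DAG nodes `Z22:(2.33).pf`, `Z22:§18.u008`–`u014`, typed in `TypedSection18`
as `Step18_u008 … Step18_u014`, `Step18_range1`, `Pf233`).

`Section18Ded183` reduced the leaf to the printed crude bound u013 plus ONE implicit input — the
negligibility `E(𝐚₂₃,𝐚₂₃) = 𝔓𝓛²Σ_j|S_j(𝐚₂₃,𝐚₂₃)| = o(𝔓)` of Proposition 7.1's error term, which needs
the two-sided size of `S_j`. This file DISCHARGES that input from the manuscript's own two-sided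
displays: the expansion u008, the range split u009, "the sum over `dr < P^{0.5}` contributes `o(α)`"
(`Step18_range1`) and the evaluations u010, u011 ("`= main + o(α)`"), together with the
UNCONDITIONAL kernel bounds on the explicit main terms (`Section18SjNormMajorant`,
`Section18SjNormSizes`):

* `norm_main18u010_le`, `norm_main18u011_le` — `‖main18u010‖, ‖main18u011‖ ≤ C(c′)𝓛⁻⁵`,
  `C(c′) = 8·10⁶e³⁴(1+2β₀)(1+4β₀+6β₀²)`, `β₀ = 3π(1+5|c′|)` (`χ` primitive, `𝓛 ≥ 3`);
* `sjNorm_of_typed` — hence `|S_j(𝐚₂₃,𝐚₂₃)| ≤ (3π + 2C(c′))𝓛⁻⁵` eventually, under (A);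
* `ecal23_of_typed` — hence `E(𝐚₂₃,𝐚₂₃) = o(𝔓)`;
* `ded183_of_typed18` — **the leaf C27**: `u008 → u009 → range1 → u010 → u011 → u013 → Ded183 c′`;
* `bound183_of_typed18` — `Eq183 → Prop71 → (same) → Skeleton.Bound183 c′`;
* `pf233_of_typed` — **the proof node `Z22:(2.33).pf` HOLDS**: `TypedSection18.Pf233 c′`, i.e.
  (2.33) `Skeleton.Ineq233 c′` from exactly the block's cited inputs and displayed steps, with no
  implicit input left (u012 and u014 turn out not to be needed).

The identities u008, u009 are PROVED in L4-t7's `Section18SjEdges` (`step18_u008_holds`,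
`step18_u009_holds`), which also derives the crude bound u013 from the range evaluations under the
`𝒴₂ⱼ` reading (`step18_u013_of_ranges`); composing, the leaf reduces to the range evaluations
"By the discussion in Section 8 and 10" plus (18.3) and Proposition 7.1.

What stays a CLAIM: the antecedents (18.3) (`Skeleton.Eq183`, itself an edge from Lemma 8.1),
Proposition 7.1, the identities u008/u009 (proved elsewhere, see below), the range claims (inputs:
"the discussion in Section 8 and 10"), and the
crude bound u013 (whose printed derivation rests on the unquantified sentence "make minor
contribution", tex L4943; its main order is certified in the tree, `Section10Certificate.Ineq233a_holds`).
No new definition, no named fact; nothing here bears on Theorems 1–2 or on Landau–Siegel zeros.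

## References

* Y. Zhang, arXiv:2211.02515v1 (2022), §18 pp. 99–100; §7 Prop. 7.1; §2 (2.33).
  [cite: Zhang2022LandauSiegel, §18 pp.99–100]
-/

noncomputable section

open Complex Real ComplexConjugate Finset

namespace Literature.NumberTheory.LFunctions.Zhang2022.Sec18SjNorm

open Skeleton Typed.Section18

section MainTerms

variable (c' : ℝ) {D : ℕ} [NeZero D] (χ : DirichletCharacter ℂ D)

/-- The constant `C(c′) = 8·10⁶e³⁴(1 + 2β₀)(1 + 4β₀ + 6β₀²)`, `β₀ = 3π(1+5|c′|)`, of the main-term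
bounds below is non-negative (written out; no definition is introduced). [folklore] -/
private theorem mainConst_nonneg (c' : ℝ) :
    0 ≤ 8e6 * Real.exp 34 * ((1 + 2 * (3 * π * (1 + 5 * |c'|))) *
      (1 + (4 * (3 * π * (1 + 5 * |c'|)) + 6 * (3 * π * (1 + 5 * |c'|)) ^ 2))) := by
  positivity

/-- **The second-range main term is `O_{c′}(𝓛⁻⁵)`** (Z22 p.100, tex L4934–L4937): for `χ` primitive
and `𝓛 ≥ 3`, `‖main18u010‖ ≤ C(c′)𝓛⁻⁵` with `C(c′) = 8·10⁶e³⁴(1+2β₀)(1+4β₀+6β₀²)`, `β₀ = 3π(1+5|c′|)`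
(`norm_mainShape_le` with the factor bounds `norm_factors_le`, the prefactor bound
`norm_prefactor_sq_le` and `1 + log⌈PT⁻²⌉ ≤ 2𝓛⁹`). Unconditional; kernel-checked.
[cite: Zhang2022LandauSiegel, §18 p.100] -/
theorem norm_main18u010_le (hL : 3 ≤ ell D) (hprim : χ.IsPrimitive) (j : ℕ) :
    ‖main18u010 c' χ j‖ ≤
      8e6 * Real.exp 34 * ((1 + 2 * (3 * π * (1 + 5 * |c'|))) *
        (1 + (4 * (3 * π * (1 + 5 * |c'|)) + 6 * (3 * π * (1 + 5 * |c'|)) ^ 2))) / ell D ^ 5 := by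
  set b : ℝ := 3 * π * (1 + 5 * |c'|) with hb
  have hb0 : 0 ≤ b := by positivity
  have hL2 : 2 ≤ ell D := by linarith
  have hℓ : 0 < ell D := by linarith
  have hF : (Ico 1 (Nsupp D)).filter
      (fun n : ℕ => bigP D ^ (0.5 : ℝ) ≤ (n : ℝ) ∧ (n : ℝ) < bigP D ^ (0.502 : ℝ)) ⊆ Ico 1 (Nsupp D) :=
    filter_subset _ _
  have h := norm_mainShape_le c' χ j hF
    (fun n => -1 - betaJ c' D j * (Real.log ((n : ℝ) / bigP D ^ (0.5 : ℝ)) : ℂ))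
    (fun n => -1 + fraky1 c' D j n) (KA := 1 + 2 * b) (KB := 1 + (4 * b + 6 * b ^ 2))
    (by positivity) (by positivity)
    (fun n hn => (norm_factors_le c' hL2 j (hF hn)).1)
    (fun n hn => (norm_factors_le c' hL2 j (hF hn)).2.2.1)
  have hpre := norm_prefactor_sq_le χ hL hprim
  have hN := one_add_log_Nsupp_le hL2
  have hN0 : 0 ≤ 1 + Real.log (Nsupp D) := by
    have := Real.log_natCast_nonneg (Nsupp D); linarith
  unfold main18u010
  refine h.trans ?_
  calc ‖500 * deriv χ.LFunction 1 / (Real.log (bigP D) : ℂ)‖ ^ 2 *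
        ((1 + 2 * b) * (1 + (4 * b + 6 * b ^ 2)) * (Real.exp 25 * (1 + Real.log (Nsupp D))))
      ≤ (4e6 * Real.exp 9 / ell D ^ 14) *
        ((1 + 2 * b) * (1 + (4 * b + 6 * b ^ 2)) * (Real.exp 25 * (2 * ell D ^ 9))) := by
        gcongr
    _ = 8e6 * (Real.exp 9 * Real.exp 25) * ((1 + 2 * b) * (1 + (4 * b + 6 * b ^ 2))) / ell D ^ 5 := by
        field_simp
        ring
    _ = 8e6 * Real.exp 34 * ((1 + 2 * b) * (1 + (4 * b + 6 * b ^ 2))) / ell D ^ 5 := by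
        rw [← Real.exp_add]; norm_num

/-- **The third-range main term (as printed, with `𝒴₁ⱼ`) is `O_{c′}(𝓛⁻⁵)`** (Z22 p.100,
tex L4939–L4941): `‖main18u011‖ ≤ C(c′)𝓛⁻⁵`, same constant. Unconditional; kernel-checked.
[cite: Zhang2022LandauSiegel, §18 p.100] -/
theorem norm_main18u011_le (hL : 3 ≤ ell D) (hprim : χ.IsPrimitive) (j : ℕ) :
    ‖main18u011 c' χ j‖ ≤
      8e6 * Real.exp 34 * ((1 + 2 * (3 * π * (1 + 5 * |c'|))) *
        (1 + (4 * (3 * π * (1 + 5 * |c'|)) + 6 * (3 * π * (1 + 5 * |c'|)) ^ 2))) / ell D ^ 5 := by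
  set b : ℝ := 3 * π * (1 + 5 * |c'|) with hb
  have hb0 : 0 ≤ b := by positivity
  have hL2 : 2 ≤ ell D := by linarith
  have hℓ : 0 < ell D := by linarith
  have hF : (Ico 1 (Nsupp D)).filter
      (fun n : ℕ => bigP D ^ (0.502 : ℝ) ≤ (n : ℝ) ∧ (n : ℝ) < bigP D ^ (0.504 : ℝ)) ⊆
        Ico 1 (Nsupp D) := filter_subset _ _
  have h := norm_mainShape_le c' χ j hF
    (fun n => 1 - betaJ c' D j * (Real.log (bigP D ^ (0.504 : ℝ) / n) : ℂ))
    (fun n => 1 + fraky1 c' D j n) (KA := 1 + 2 * b) (KB := 1 + (4 * b + 6 * b ^ 2))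
    (by positivity) (by positivity)
    (fun n hn => (norm_factors_le c' hL2 j (hF hn)).2.1)
    (fun n hn => (norm_factors_le c' hL2 j (hF hn)).2.2.2)
  have hpre := norm_prefactor_sq_le χ hL hprim
  have hN := one_add_log_Nsupp_le hL2
  have hN0 : 0 ≤ 1 + Real.log (Nsupp D) := by
    have := Real.log_natCast_nonneg (Nsupp D); linarith
  unfold main18u011
  refine h.trans ?_
  calc ‖500 * deriv χ.LFunction 1 / (Real.log (bigP D) : ℂ)‖ ^ 2 *
        ((1 + 2 * b) * (1 + (4 * b + 6 * b ^ 2)) * (Real.exp 25 * (1 + Real.log (Nsupp D))))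
      ≤ (4e6 * Real.exp 9 / ell D ^ 14) *
        ((1 + 2 * b) * (1 + (4 * b + 6 * b ^ 2)) * (Real.exp 25 * (2 * ell D ^ 9))) := by
        gcongr
    _ = 8e6 * (Real.exp 9 * Real.exp 25) * ((1 + 2 * b) * (1 + (4 * b + 6 * b ^ 2))) / ell D ^ 5 := by
        field_simp
        ring
    _ = 8e6 * Real.exp 34 * ((1 + 2 * b) * (1 + (4 * b + 6 * b ^ 2))) / ell D ^ 5 := by
        rw [← Real.exp_add]; norm_num

end MainTerms

/-! ## The two-sided size of `S_j(𝐚₂₃,𝐚₂₃)` from the displayed range evaluations -/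

section TwoSided

variable (c' : ℝ)

/-- For every real `M` there is `D₀` with `M ≤ log D` for all `D ≥ D₀`. [folklore] -/
private theorem exists_nat_le_log (M : ℝ) : ∃ D₀ : ℕ, ∀ D : ℕ, D₀ ≤ D → M ≤ Real.log D := by
  refine ⟨⌈Real.exp M⌉₊ + 1, fun D hD => ?_⟩
  have h1 : Real.exp M ≤ D := by
    have : (⌈Real.exp M⌉₊ : ℝ) + 1 ≤ D := by exact_mod_cast hD
    linarith [Nat.le_ceil (Real.exp M)]
  have hD0 : (0 : ℝ) < D := lt_of_lt_of_le (Real.exp_pos M) h1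
  rw [Real.le_log_iff_exp_le hD0]
  exact h1

/-- **`|S_j(𝐚₂₃,𝐚₂₃)| ≪_{c′} 𝓛⁻⁵` from the displayed range evaluations** (Z22 p.100,
tex L4921–L4942): the expansion `S_j = Σ_rΣ_d …` (u008), its split into the three `dr`-ranges
(u009), "the sum over `dr < P^{0.5}` contributes `o(α)`" (prose L4932, `Step18_range1`) and the two
evaluations "`= main + o(α)`" (u010, u011 as printed) give, with `α = π𝓛⁻⁹` and the unconditional
`‖main18u010‖, ‖main18u011‖ ≤ C(c′)𝓛⁻⁵`, a constant `C` with `|S_j(𝐚₂₃,𝐚₂₃)| ≤ C𝓛⁻⁵`, `1 ≤ j ≤ 3`,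
for all large `D` under (A). Kernel-checked bookkeeping. [cite: Zhang2022LandauSiegel, §18 p.100] -/
theorem sjNorm_of_typed (h8 : Step18_u008 c') (h9 : Step18_u009 c') (hr1 : Step18_range1 c')
    (h10 : Step18_u010 c') (h11 : Step18_u011 c') :
    ∃ C : ℝ, ForAllLarge fun D _ χ => AssumptionA D χ → ∀ j ∈ ({1, 2, 3} : Finset ℕ),
      ‖Sj c' D j (a23 χ) (a23 χ)‖ ≤ C / ell D ^ 5 := by
  set K : ℝ := 8e6 * Real.exp 34 * ((1 + 2 * (3 * π * (1 + 5 * |c'|))) *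
      (1 + (4 * (3 * π * (1 + 5 * |c'|)) + 6 * (3 * π * (1 + 5 * |c'|)) ^ 2))) with hK
  have hK0 : 0 ≤ K := mainConst_nonneg c'
  refine ⟨3 * π + 2 * K, ?_⟩
  obtain ⟨D₁, h⟩ := (((h8.and h9).and (hr1 1 one_pos)).and (h10 1 one_pos)).and (h11 1 one_pos)
  obtain ⟨D₂, hD₂⟩ := exists_nat_le_log 3
  refine ⟨max D₁ D₂, fun D _ χ hD hq hp hA j hj => ?_⟩
  obtain ⟨⟨⟨⟨h8D, h9D⟩, hr1D⟩, h10D⟩, h11D⟩ := h D χ (le_trans (le_max_left _ _) hD) hq hp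
  have hL3 : 3 ≤ ell D := hD₂ D (le_trans (le_max_right _ _) hD)
  have hℓ : 0 < ell D := by linarith
  have hL1 : 1 ≤ ell D := by linarith
  have e8 := h8D j hj
  have e9 := h9D j hj
  have er := hr1D hA j hj
  have e10 := h10D hA j hj
  have e11 := h11D hA j hj
  have m10 := norm_main18u010_le c' χ hL3 hp j
  have m11 := norm_main18u011_le c' χ hL3 hp j
  -- `α = π𝓛⁻⁹ ≤ π𝓛⁻⁵`
  have hα : 1 * alpha D ≤ π / ell D ^ 5 := by
    rw [one_mul, Section2.alpha_eq_pi_div_ell9]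
    apply div_le_div_of_nonneg_left Real.pi_pos.le (by positivity)
    exact pow_le_pow_right₀ hL1 (by norm_num)
  rw [e8, e9]
  set R1 := Sj23Range c' χ j 0 (bigP D ^ (0.5 : ℝ))
  set R2 := Sj23Range c' χ j (bigP D ^ (0.5 : ℝ)) (bigP D ^ (0.502 : ℝ))
  set R3 := Sj23Range c' χ j (bigP D ^ (0.502 : ℝ)) (bigP D ^ (0.504 : ℝ))
  calc ‖R1 + R2 + R3‖ ≤ ‖R1‖ + ‖R2‖ + ‖R3‖ := norm_add₃_le
    _ ≤ ‖R1‖ + (‖R2 - main18u010 c' χ j‖ + ‖main18u010 c' χ j‖) +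
        (‖R3 - main18u011 c' χ j‖ + ‖main18u011 c' χ j‖) := by
        gcongr
        · exact norm_le_norm_sub_add _ _
        · exact norm_le_norm_sub_add _ _
    _ ≤ π / ell D ^ 5 + (π / ell D ^ 5 + K / ell D ^ 5) + (π / ell D ^ 5 + K / ell D ^ 5) := by
        gcongr
        · exact er.trans hα
        · exact e10.trans hα
        · exact e11.trans hα
    _ = (3 * π + 2 * K) / ell D ^ 5 := by ring

/-- **The implicit input of "This yields (2.33) by Lemma 8.1 and Proposition 7.1" DISCHARGED from the
displayed steps** (Z22 p.100, tex L4955): Prop. 7.1's error term at `𝐚₂₃`,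
`E(𝐚₂₃,𝐚₂₃) = 𝔓𝓛²Σ_j|S_j(𝐚₂₃,𝐚₂₃)|`, is `o(𝔓)` given u008, u009, the first-range claim and the
evaluations u010, u011 (`E ≤ 3C𝓛²⁻⁵𝔓 = 3C𝔓/𝓛³`). Kernel-checked.
[cite: Zhang2022LandauSiegel, §18 p.100] -/
theorem ecal23_of_typed (h8 : Step18_u008 c') (h9 : Step18_u009 c') (hr1 : Step18_range1 c')
    (h10 : Step18_u010 c') (h11 : Step18_u011 c') :
    ∀ ε : ℝ, 0 < ε → ForAllLarge fun D _ χ => AssumptionA D χ →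
      Ecal c' D (a23 χ) (a23 χ) ≤ ε * frakP D := by
  intro ε hε
  obtain ⟨C, D₁, hC⟩ := sjNorm_of_typed c' h8 h9 hr1 h10 h11
  obtain ⟨D₂, hD₂⟩ := exists_nat_le_log (max 1 (3 * |C| / ε + 1))
  refine ⟨max D₁ D₂, fun D _ χ hD hq hp hA => ?_⟩
  have hlog : max 1 (3 * |C| / ε + 1) ≤ ell D := hD₂ D (le_trans (le_max_right _ _) hD)
  have hL1 : 1 ≤ ell D := le_trans (le_max_left _ _) hlog
  have hLbig : 3 * |C| / ε + 1 ≤ ell D := le_trans (le_max_right _ _) hlog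
  have hℓ : 0 < ell D := by linarith
  have hP : 0 ≤ frakP D := frakP_nonneg D
  have hS : ∀ j ∈ ({1, 2, 3} : Finset ℕ), ‖Sj c' D j (a23 χ) (a23 χ)‖ ≤ |C| / ell D ^ 5 := by
    intro j hj
    refine (hC D χ (le_trans (le_max_left _ _) hD) hq hp hA j hj).trans ?_
    gcongr; exact le_abs_self C
  have h1 := hS 1 (by simp)
  have h2 := hS 2 (by simp)
  have h3 := hS 3 (by simp)
  have hkey : ell D ^ 2 * (3 * (|C| / ell D ^ 5)) ≤ ε := by
    have e : ell D ^ 2 * (3 * (|C| / ell D ^ 5)) = 3 * |C| / ell D ^ 3 := by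
      field_simp
    rw [e]
    have hL3' : ell D ≤ ell D ^ 3 := by
      calc ell D = ell D ^ 1 := (pow_one _).symm
        _ ≤ ell D ^ 3 := pow_le_pow_right₀ hL1 (by norm_num)
    calc 3 * |C| / ell D ^ 3 ≤ 3 * |C| / ell D :=
          div_le_div_of_nonneg_left (by positivity) hℓ hL3'
      _ ≤ ε := by
          rw [div_le_iff₀ hℓ]
          have : 3 * |C| / ε ≤ ell D - 1 := by linarith
          have h' := (div_le_iff₀ hε).mp this
          nlinarith
  unfold Ecal
  calc frakP D * ell D ^ 2 *
        (‖Sj c' D 1 (a23 χ) (a23 χ)‖ + ‖Sj c' D 2 (a23 χ) (a23 χ)‖ + ‖Sj c' D 3 (a23 χ) (a23 χ)‖)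
      ≤ frakP D * ell D ^ 2 * (|C| / ell D ^ 5 + |C| / ell D ^ 5 + |C| / ell D ^ 5) := by gcongr
    _ = frakP D * (ell D ^ 2 * (3 * (|C| / ell D ^ 5))) := by ring
    _ ≤ frakP D * ε := by gcongr
    _ = ε * frakP D := mul_comm _ _

end TwoSided

/-! ## The leaf and the proof node, with no implicit input left -/

section Leaf

variable (c' : ℝ)

/-- **The cone leaf C27 `Skeleton.Ded183 c′` from the typed §18 displays** (the bridge wanted by
L4-t7): u008, u009, the first-range claim, u010, u011 (two-sided range evaluations) and the crude bound
u013 imply the skeleton's proof node `Ded183 c′ := Eq183 → Prop71 → Lemma101 → Lemma102 → Bound183`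
(via `Sec18Ded183.ded183_of_steps` and `ecal23_of_typed`; `Step18_u013 c′` is definitionally the
hypothesis of `ded183_of_steps`). Kernel-checked. [cite: Zhang2022LandauSiegel, §18 pp.99–100] -/
theorem ded183_of_typed18 (h8 : Step18_u008 c') (h9 : Step18_u009 c') (hr1 : Step18_range1 c')
    (h10 : Step18_u010 c') (h11 : Step18_u011 c') (h13 : Step18_u013 c') : Skeleton.Ded183 c' :=
  Sec18Ded183.ded183_of_steps c' h13 (ecal23_of_typed c' h8 h9 hr1 h10 h11)

/-- `Skeleton.Bound183 c′` (the bound behind (2.33)) from (18.3), Prop. 7.1 and the typed §18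
displays u008–u011, u013. Kernel-checked. [cite: Zhang2022LandauSiegel, §18 pp.99–100] -/
theorem bound183_of_typed18 (h183 : Eq183 c') (h71 : Prop71 c') (h8 : Step18_u008 c')
    (h9 : Step18_u009 c') (hr1 : Step18_range1 c') (h10 : Step18_u010 c') (h11 : Step18_u011 c')
    (h13 : Step18_u013 c') : Skeleton.Bound183 c' :=
  Sec18Ded183.bound183_of_steps c' h183 h71 (Sec18Ded183.step18_u014_of_u013 c' h13)
    (ecal23_of_typed c' h8 h9 hr1 h10 h11)

/-- **The proof node `Z22:(2.33).pf` (`TypedSection18.Pf233 c′`) HOLDS**: (2.33)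
(`Skeleton.Ineq233 c′`) follows from the block's cited inputs (18.3) and Proposition 7.1 together
with its displayed steps u008–u014 (u012 and u014 are not even needed: u014 ⇐ u013, and the
"major contribution" display u012 is bypassed by the unconditional main-term bounds), through
`Sec18Ded183.ineq233_of_steps` (`Skeleton.ineq233_of_bound`, `𝔞 ≫ 1`) and `ecal23_of_typed` —
no implicit input remains. What stays a CLAIM is each antecedent (in particular the crude bound u013,
whose printed derivation rests on the unquantified "minor contribution" sentence, tex L4943).
Kernel-checked. [cite: Zhang2022LandauSiegel, §18 pp.99–100; §2 (2.33)] -/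
theorem pf233_of_typed : Pf233 c' :=
  fun h183 h71 h8 h9 hr1 h10 h11 _ h13 _ =>
    Sec18Ded183.ineq233_of_steps c' h183 h71 h13 (ecal23_of_typed c' h8 h9 hr1 h10 h11)

/-- `Pf233` holds for all parameters — `_holds` alias of `pf233_of_typed` above (appended
2026-08-28, D-0026 bookkeeping: the proof term is the existing theorem of this file; no
statement, definition or attribute is edited; no new named fact).
[cite: Zhang2022LandauSiegel, §18 pp.99–100; §2 (2.33)] -/
theorem _root_.Literature.NumberTheory.LFunctions.Zhang2022.Typed.Section18.Pf233_holds :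
    Pf233 c' :=
  pf233_of_typed c'


end Leaf

end Literature.NumberTheory.LFunctions.Zhang2022.Sec18SjNorm
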